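/-
Copyright (c) 2026 the pub-hodgecm-mathlib formalisation cell (harness21).  Prover seat hodgecm-mathlib-K2E5-p17 (g5), Track B «K2-LIT» ∕ h413
(`stmt-HodgeConjecture-24833`), line `K2_E3_EllipticInputs`, leaf (nsc-S-A′) H-layer (architect K2E3-p25 (g0); dealer D76 LEV-2, RULINGS #3 (R-9)):
COINVARIANTS IN STAGES.  2026-09-04.
-/
import Literature.NumberTheory.Automorphic.WhittakerTwistedJacquet   -- ★ `Representation.charTwist` (θ-localisation), Mathlib `Representation.Coinvariants`
import HarnessLib

/-!
# D76 LEV-2: coinvariants in stages — `V_{S ⊔ H} = V ⧸ (V(S) + V(H))`, `(V_S)_H ≅ V_G`, and the twisted reading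

Cell `pub/hodgecm-mathlib` (D-0151), Track B, seat K2E5-p17 (g5).  `--supports stmt-HodgeConjecture-24833 --as helper`; THEOREMS ONLY (no definition ∕ instance ∕
notation ∕ named fact ∕ `sorry`); never imports `Cruxes/…/Lines`.  COUNT-NEUTRAL.  Brick LEV-2 of the architect's H-layer rule (lev) (MEMO
`K2/K2E3-p25/g0/MEMO-H4-residues.v1.K2E3-p25-g0.md` §1): Bernstein–Zelevinsky's «localisation in stages» [BZ-II 1977, §1.8–1.9; Z-II 1980, 3.7(b)] in the tree's
vocabulary — Mathlib `Representation.Coinvariants` ∕ `Coinvariants.ker` ∕ `Coinvariants.mk` ∕ `Representation.toCoinvariants` and the ★ `θ`-twisted restriction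
`Representation.charTwist` (whose coinvariants ARE the twisted coinvariants `V_{H,θ}`).  Everything is linear algebra over any commutative ring `k` and any group.

* §1 KERNELS.  `ker_comp_le` ∕ `ker_comp_subtype_mono` (monotonicity); **`ker_comp_sup_eq`**: `V(S ⊔ H) = V(S) + V(H)` as submodules of `V` — the whole content is
  `ρ(g₁g₂)v − v = (ρ(g₁) − 1)(ρ(g₂)v) + (ρ(g₂)v − v)` — and `ker_eq_sup_of_sup_eq_top`.
* §2 STAGES.  For `S ⊴ G`, `S ⊔ H = G`: **`exists_coinvariants_stages`** — a linear equivalence `V_G ≃ (V_S)_H` (`H` acting on `V_S` through Mathlib `toCoinvariants`)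
  sending `[v] ↦ [[v]]`; `mk_mk_eq_zero_iff`, `subsingleton_coinvariants_iff_stages`.
* §3 TWISTED READING.  `ker_comp_equiv_eq` (kernels along a group isomorphism); **`ker_charTwist_eq_sup`**: for `L = S₀ ⊔ H₀ ≤ G₀` and a character `χ` of `L`,
  `V(L, χ) = V(S₀, χ|S₀) + V(H₀, χ|H₀)` — i.e. `V_{L,χ} = (V_{S₀,χ|})_{H₀,χ|}` at the level of kernels in `V` (the form rule (lev) uses with `L = U₃ = U_Q·U_{α₁}`,
  `χ ∈ {ψ_nd, ψ′}`: both restrict to the SAME `Ψ₁` on `U_Q`, so `A := V_{U_Q,Ψ₁}` serves both, with `A_{U_{α₁},ψ₀} = V_{U₃,ψ_nd}` and `A_{U_{α₁},1} = V_{U₃,ψ′}`).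

HONEST LABEL: HC_CM is proved only modulo the 7 printed citations (2 remaining named inputs: hLiu418 = stmt-HodgeConjecture-24832, h413 =
stmt-HodgeConjecture-24833) until rung 0 closes; count-neutral helper, closes no socket.

References: Bernstein–Zelevinsky 1977 (ASENS) §1.8–1.9 (the functor `r_{U,θ}`, localisation in stages) [cite: BernsteinZelevinskyASENS1977, §1.8–1.9]; Zelevinsky
1980 §3.7 [cite: Zelevinsky1980, §3.7]; Bump 1997 §4.4 p. 462 (`V_{N,ψ}`) [cite: Bump1997, §4.4 p. 462].
-/

set_option autoImplicit false
set_option linter.dupNamespace false   -- `Summit.HodgeConjecture.HodgeConjecture.…` (D-0017 nested layout; lakefile exemption for Summits)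

noncomputable section

open Representation Representation.Coinvariants

namespace Summit.HodgeConjecture.HodgeConjecture.Cruxes.H413.K2E3CoinvariantsInStages

variable {k G V : Type*} [CommRing k] [Group G] [AddCommGroup V] [Module k V]

/-! ## §1 Kernels: `V(S ⊔ H) = V(S) + V(H)` -/
section Kernels

/-- Pulling a representation back along a group homomorphism shrinks the coinvariant kernel: `V(ρ ∘ f) ≤ V(ρ)`. [cite: BernsteinZelevinskyASENS1977, §1.8] -/
theorem ker_comp_le {G' : Type*} [Group G'] (ρ : Representation k G V) (f : G' →* G) :
    Coinvariants.ker (ρ.comp f) ≤ Coinvariants.ker ρ :=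
  Submodule.span_le.2 (by
    rintro _ ⟨⟨g, v⟩, rfl⟩
    exact sub_mem_ker (ρ := ρ) (f g) v)

/-- … with equality when the homomorphism is surjective. [cite: BernsteinZelevinskyASENS1977, §1.8] -/
theorem ker_comp_eq_of_surjective {G' : Type*} [Group G'] (ρ : Representation k G V) {f : G' →* G} (hf : Function.Surjective f) :
    Coinvariants.ker (ρ.comp f) = Coinvariants.ker ρ := by
  refine le_antisymm (ker_comp_le ρ f) (Submodule.span_le.2 ?_)
  rintro _ ⟨⟨g, v⟩, rfl⟩
  obtain ⟨g', rfl⟩ := hf g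
  exact sub_mem_ker (ρ := ρ.comp f) g' v

/-- Monotonicity in the subgroup: `S ≤ T ⇒ V(S) ≤ V(T)`. [cite: BernsteinZelevinskyASENS1977, §1.8] -/
theorem ker_comp_subtype_mono (ρ : Representation k G V) {S T : Subgroup G} (h : S ≤ T) :
    Coinvariants.ker (ρ.comp S.subtype) ≤ Coinvariants.ker (ρ.comp T.subtype) :=
  Submodule.span_le.2 (by
    rintro _ ⟨⟨s, v⟩, rfl⟩
    exact sub_mem_ker (ρ := ρ.comp T.subtype) ⟨s, h s.2⟩ v)

/-- `V(S) ≤ V(G)`. [cite: BernsteinZelevinskyASENS1977, §1.8] -/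
theorem ker_comp_subtype_le (ρ : Representation k G V) (S : Subgroup G) :
    Coinvariants.ker (ρ.comp S.subtype) ≤ Coinvariants.ker ρ :=
  ker_comp_le ρ S.subtype

/-- **`V(S ⊔ H) = V(S) + V(H)`** (submodules of `V`): the coinvariant kernel of the subgroup generated by `S` and `H` is the sum of the two kernels — because
`{g | ∀ v, ρ(g)v − v ∈ V(S) + V(H)}` is a subgroup (`ρ(g₁g₂)v − v = (ρ(g₁)(ρ(g₂)v) − ρ(g₂)v) + (ρ(g₂)v − v)`, `ρ(g⁻¹)v − v = −(ρ(g)w − w)` for `w = ρ(g⁻¹)v`)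
containing `S` and `H`.  No normality is needed. [cite: BernsteinZelevinskyASENS1977, §1.9] [cite: Zelevinsky1980, §3.7] -/
theorem ker_comp_sup_eq (ρ : Representation k G V) (S H : Subgroup G) :
    Coinvariants.ker (ρ.comp (S ⊔ H).subtype) = Coinvariants.ker (ρ.comp S.subtype) ⊔ Coinvariants.ker (ρ.comp H.subtype) := by
  refine le_antisymm ?_ (sup_le (ker_comp_subtype_mono ρ le_sup_left) (ker_comp_subtype_mono ρ le_sup_right))
  -- the subgroup of elements acting trivially modulo `K := V(S) + V(H)`
  set K : Submodule k V := Coinvariants.ker (ρ.comp S.subtype) ⊔ Coinvariants.ker (ρ.comp H.subtype) with hK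
  let M : Subgroup G :=
    { carrier := {g : G | ∀ v : V, ρ g v - v ∈ K}
      mul_mem' := fun {a b} ha hb v => by
        have h : ρ (a * b) v - v = (ρ a (ρ b v) - ρ b v) + (ρ b v - v) := by rw [map_mul, Module.End.mul_apply]; abel
        rw [h]; exact K.add_mem (ha _) (hb _)
      one_mem' := fun v => by rw [map_one, Module.End.one_apply, sub_self]; exact K.zero_mem
      inv_mem' := fun {a} ha v => by
        have h : ρ a⁻¹ v - v = -(ρ a (ρ a⁻¹ v) - ρ a⁻¹ v) := by
          rw [← Module.End.mul_apply, ← map_mul, mul_inv_cancel, map_one, Module.End.one_apply]; abel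
        rw [h]; exact K.neg_mem (ha _) }
  have hS : S ≤ M := fun s hs v => Submodule.mem_sup_left (sub_mem_ker (ρ := ρ.comp S.subtype) ⟨s, hs⟩ v)
  have hH : H ≤ M := fun h hh v => Submodule.mem_sup_right (sub_mem_ker (ρ := ρ.comp H.subtype) ⟨h, hh⟩ v)
  have hle : S ⊔ H ≤ M := sup_le hS hH
  refine Submodule.span_le.2 ?_
  rintro _ ⟨⟨g, v⟩, rfl⟩
  exact hle g.2 v

/-- `S ⊔ H = G ⇒ V(G) = V(S) + V(H)`. [cite: BernsteinZelevinskyASENS1977, §1.9] -/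
theorem ker_eq_sup_of_sup_eq_top (ρ : Representation k G V) {S H : Subgroup G} (hSH : S ⊔ H = ⊤) :
    Coinvariants.ker ρ = Coinvariants.ker (ρ.comp S.subtype) ⊔ Coinvariants.ker (ρ.comp H.subtype) := by
  rw [← ker_comp_sup_eq, hSH]
  exact (ker_comp_eq_of_surjective ρ (f := (⊤ : Subgroup G).subtype) fun g => ⟨⟨g, Subgroup.mem_top g⟩, rfl⟩).symm

end Kernels

/-! ## §2 Stages: `(V_S)_H ≅ V_G` for `S ⊴ G`, `S ⊔ H = G` -/
section Stages

variable (ρ : Representation k G V) (S : Subgroup G) [S.Normal] (H : Subgroup G)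

/-- **COINVARIANTS IN STAGES.**  For a normal subgroup `S ⊴ G` and a subgroup `H` with `S ⊔ H = G`, the iterated coinvariants `(V_S)_H` — `H` acting on `V_S = V ⧸ V(S)`
through Mathlib's `Representation.toCoinvariants` — are canonically the full coinvariants: a linear equivalence `V_G ≃ₗ (V_S)_H`, `[v] ↦ [[v]]`.  (With `ρ` a `θ`-twisted
restriction `ω.charTwist L θ` this is Bernstein–Zelevinsky's `r_{H,θ|} ∘ r_{S,θ|} = r_{L,θ}`.) [cite: BernsteinZelevinskyASENS1977, §1.9 (c)] [cite: Zelevinsky1980, §3.7] -/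
theorem exists_coinvariants_stages (hSH : S ⊔ H = ⊤) :
    ∃ e : ρ.Coinvariants ≃ₗ[k] Coinvariants ((ρ.toCoinvariants S).comp H.subtype),
      ∀ v : V, e (Coinvariants.mk ρ v) = Coinvariants.mk ((ρ.toCoinvariants S).comp H.subtype) (Coinvariants.mk (ρ.comp S.subtype) v) := by
  -- forward: `V → V_S → (V_S)_H` kills `V(G) = V(S) + V(H)`
  set τ : Representation k ↥H (Coinvariants (ρ.comp S.subtype)) := (ρ.toCoinvariants S).comp H.subtype with hτ
  set f : V →ₗ[k] τ.Coinvariants := (Coinvariants.mk τ) ∘ₗ (Coinvariants.mk (ρ.comp S.subtype)) with hf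
  have hfS : Coinvariants.ker (ρ.comp S.subtype) ≤ LinearMap.ker f := fun x hx => by
    rw [LinearMap.mem_ker, hf, LinearMap.comp_apply, (Coinvariants.mk_eq_zero _).2 hx, map_zero]
  have hfH : Coinvariants.ker (ρ.comp H.subtype) ≤ LinearMap.ker f := by
    refine Submodule.span_le.2 ?_
    rintro _ ⟨⟨h, v⟩, rfl⟩
    rw [SetLike.mem_coe, LinearMap.mem_ker, hf, LinearMap.comp_apply, map_sub, map_sub]
    have : Coinvariants.mk (ρ.comp S.subtype) ((ρ.comp H.subtype) h v) = τ h (Coinvariants.mk (ρ.comp S.subtype) v) := rfl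
    rw [this, sub_eq_zero]
    exact Coinvariants.mk_self_apply τ h _
  have hfG : ∀ g : G, f ∘ₗ ρ g = f := fun g => LinearMap.ext fun v => by
    rw [LinearMap.comp_apply, ← sub_eq_zero, ← map_sub, ← LinearMap.mem_ker]
    have hmem : ρ g v - v ∈ Coinvariants.ker ρ := sub_mem_ker g v
    rw [ker_eq_sup_of_sup_eq_top ρ hSH] at hmem
    exact (sup_le hfS hfH) hmem
  set F : ρ.Coinvariants →ₗ[k] τ.Coinvariants := Coinvariants.lift ρ f hfG with hF
  -- backward: `V_S → V_G` is `H`-invariant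
  set b : Coinvariants (ρ.comp S.subtype) →ₗ[k] ρ.Coinvariants :=
    Coinvariants.lift (ρ.comp S.subtype) (Coinvariants.mk ρ) fun s => LinearMap.ext fun v => Coinvariants.mk_self_apply ρ (s : G) v with hb
  have hbτ : ∀ h : ↥H, b ∘ₗ τ h = b := fun h => Coinvariants.hom_ext (LinearMap.ext fun v => by
    show b (τ h (Coinvariants.mk (ρ.comp S.subtype) v)) = b (Coinvariants.mk (ρ.comp S.subtype) v)
    have : τ h (Coinvariants.mk (ρ.comp S.subtype) v) = Coinvariants.mk (ρ.comp S.subtype) (ρ (h : G) v) := rfl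
    rw [this, hb, Coinvariants.lift_mk, Coinvariants.lift_mk]
    exact Coinvariants.mk_self_apply ρ (h : G) v)
  set B : τ.Coinvariants →ₗ[k] ρ.Coinvariants := Coinvariants.lift τ b hbτ with hB
  have hFB : ∀ v, F (Coinvariants.mk ρ v) = Coinvariants.mk τ (Coinvariants.mk (ρ.comp S.subtype) v) := fun v => rfl
  have hBF : ∀ v, B (Coinvariants.mk τ (Coinvariants.mk (ρ.comp S.subtype) v)) = Coinvariants.mk ρ v := fun v => rfl
  refine ⟨LinearEquiv.ofLinear F B ?_ ?_, hFB⟩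
  · refine Coinvariants.hom_ext (Coinvariants.hom_ext (LinearMap.ext fun v => ?_))
    show F (B (Coinvariants.mk τ (Coinvariants.mk (ρ.comp S.subtype) v))) = Coinvariants.mk τ (Coinvariants.mk (ρ.comp S.subtype) v)
    rw [hBF, hFB]
  · refine Coinvariants.hom_ext (LinearMap.ext fun v => ?_)
    show B (F (Coinvariants.mk ρ v)) = Coinvariants.mk ρ v
    rw [hFB, hBF]

/-- Stages at the level of classes: `[[v]] = 0` in `(V_S)_H` iff `[v] = 0` in `V_G`. [cite: BernsteinZelevinskyASENS1977, §1.9 (c)] -/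
theorem mk_mk_eq_zero_iff (hSH : S ⊔ H = ⊤) (v : V) :
    Coinvariants.mk ((ρ.toCoinvariants S).comp H.subtype) (Coinvariants.mk (ρ.comp S.subtype) v) = 0 ↔ Coinvariants.mk ρ v = 0 := by
  obtain ⟨e, he⟩ := exists_coinvariants_stages ρ S H hSH
  rw [← he, e.map_eq_zero_iff]

/-- Stages for vanishing: `V_G = 0 ↔ (V_S)_H = 0`. [cite: BernsteinZelevinskyASENS1977, §1.9 (c)] -/
theorem subsingleton_coinvariants_iff_stages (hSH : S ⊔ H = ⊤) :
    Subsingleton ρ.Coinvariants ↔ Subsingleton (Coinvariants ((ρ.toCoinvariants S).comp H.subtype)) := by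
  obtain ⟨e, -⟩ := exists_coinvariants_stages ρ S H hSH
  exact Equiv.subsingleton_congr e.toEquiv

end Stages

/-! ## §3 The twisted reading: `V(L, χ) = V(S₀, χ|S₀) + V(H₀, χ|H₀)` for `L = S₀ ⊔ H₀` -/
section Twisted

variable {G₀ : Type*} [Group G₀] (ω : Representation k G₀ V)

/-- Kernels along a group isomorphism of the source: `V(ρ ∘ e) = V(ρ)`. [cite: BernsteinZelevinskyASENS1977, §1.8] -/
theorem ker_comp_equiv_eq {G' : Type*} [Group G'] (ρ : Representation k G V) (e : G' ≃* G) :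
    Coinvariants.ker (ρ.comp e.toMonoidHom) = Coinvariants.ker ρ :=
  ker_comp_eq_of_surjective ρ e.surjective

/-- Restricting a twisted restriction: for `S₀ ≤ L`, the `χ`-twisted restriction of `ω` to `L`, pulled back to `S₀` (seen inside `L`), has the same coinvariant kernel as
the `χ|S₀`-twisted restriction of `ω` to `S₀`: `V((ω.charTwist L χ)|_{S₀}) = V(S₀, χ|S₀)`. [cite: BernsteinZelevinskyASENS1977, §1.8 (b)] -/
theorem ker_charTwist_comp_subgroupOf_eq (L S₀ : Subgroup G₀) (hS : S₀ ≤ L) (χ : ↥L →* kˣ) :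
    Coinvariants.ker ((ω.charTwist L χ).comp (S₀.subgroupOf L).subtype) =
      Coinvariants.ker (ω.charTwist S₀ (χ.comp (Subgroup.inclusion hS))) := by
  refine le_antisymm (Submodule.span_le.2 ?_) (Submodule.span_le.2 ?_)
  · rintro _ ⟨⟨s, v⟩, rfl⟩
    refine mem_ker_of_eq (ρ := ω.charTwist S₀ (χ.comp (Subgroup.inclusion hS))) ⟨(s : ↥L), s.2⟩ v _ ?_
    simp only [MonoidHom.comp_apply, charTwist_apply, Subgroup.coe_subtype]
    rfl
  · rintro _ ⟨⟨s, v⟩, rfl⟩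
    refine mem_ker_of_eq (ρ := (ω.charTwist L χ).comp (S₀.subgroupOf L).subtype) ⟨⟨s, hS s.2⟩, by exact s.2⟩ v _ ?_
    simp only [MonoidHom.comp_apply, charTwist_apply, Subgroup.coe_subtype]
    rfl

/-- **TWISTED COINVARIANTS IN STAGES, at the level of kernels in `V`.**  `L, S₀, H₀ ≤ G₀` subgroups with `S₀ ⊔ H₀ = L`, `χ : L → kˣ` a character; then
`V(L, χ) = V(S₀, χ|S₀) + V(H₀, χ|H₀)`, where `V(H, θ) = Coinvariants.ker (ω.charTwist H θ) = ⟨θ(h)⁻¹ω(h)v − v⟩` is the kernel of `V → V_{H,θ}` (★ `charTwist`).  Hence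
`V_{L,χ} = V ⧸ (V(S₀,χ|) + V(H₀,χ|)) = (V_{S₀,χ|})_{H₀,χ|}`; with `L = U₃`, `S₀ = U_Q`, `H₀ = U_{α₁}` and `χ = ψ_nd` resp. `χ = ψ′` (same restriction `Ψ₁` to `U_Q`) this is the
pair of identities `A_{U_{α₁},ψ₀} = V_{U₃,ψ_nd}`, `A_{U_{α₁},1} = V_{U₃,ψ′}` of rule (lev). [cite: BernsteinZelevinskyASENS1977, §1.9 (c)] [cite: Zelevinsky1980, §3.7] -/
theorem ker_charTwist_eq_sup (L S₀ H₀ : Subgroup G₀) (hS : S₀ ≤ L) (hH : H₀ ≤ L) (hSH : S₀ ⊔ H₀ = L) (χ : ↥L →* kˣ) :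
    Coinvariants.ker (ω.charTwist L χ) =
      Coinvariants.ker (ω.charTwist S₀ (χ.comp (Subgroup.inclusion hS))) ⊔ Coinvariants.ker (ω.charTwist H₀ (χ.comp (Subgroup.inclusion hH))) := by
  have htop : S₀.subgroupOf L ⊔ H₀.subgroupOf L = ⊤ := by
    rw [← Subgroup.subgroupOf_sup hS hH, hSH, Subgroup.subgroupOf_self]
  rw [ker_eq_sup_of_sup_eq_top (ω.charTwist L χ) htop, ker_charTwist_comp_subgroupOf_eq ω L S₀ hS χ, ker_charTwist_comp_subgroupOf_eq ω L H₀ hH χ]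

/-- The same for ONE subgroup pair inside `G₀` with `S₀ ⊔ H₀ = ⊤` and a character of `G₀`: `V(G₀, χ) = V(S₀, χ|) + V(H₀, χ|)` (`ω.twist χ⁻¹` has kernel `V(G₀,χ)`).
[cite: BernsteinZelevinskyASENS1977, §1.9 (c)] -/
theorem ker_twist_inv_eq_sup (S₀ H₀ : Subgroup G₀) (hSH : S₀ ⊔ H₀ = ⊤) (χ : G₀ →* kˣ) :
    Coinvariants.ker (ω.twist χ⁻¹) =
      Coinvariants.ker (ω.charTwist S₀ (χ.comp S₀.subtype)) ⊔ Coinvariants.ker (ω.charTwist H₀ (χ.comp H₀.subtype)) := by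
  rw [ker_eq_sup_of_sup_eq_top (ω.twist χ⁻¹) hSH]
  rfl

end Twisted

end Summit.HodgeConjecture.HodgeConjecture.Cruxes.H413.K2E3CoinvariantsInStages

end
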